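import Summits.CriticalPhenomena.PercolationContinuityZ3.Theorems.Transplant.FKConnectivityAllQAntipodalSquareCert
import Literature.Combinatorics.Matroid.HeppBound
import Mathlib.Combinatorics.Matroid.Constructions
import HarnessLib

/-!
# Connectivity correlation inequalities for `φ_{w,q}`, `q < 1` — file (DEFINITION): the MATROID FRAME and **CONJECTURE C**
# (`(ID)` for every matroid: the doubly odd nullity-level kernel lies in the square cone)

Definitions file (`--supports stmt-CriticalPhenomena-4575`), stmt lineage (stmt-g40) for the FK sub-lane `prim-bschramm-fk-2` (gens 39–41) of the
post-continuity programme; builds on p205010 (kernel theorem, internal audit signed; external expert review pending).  No named facts, no sorries,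
no instances, no notation, standard axioms; ONE statement is recorded `@[conjecture]` (NOT asserted).  Typed under director-frontier g14's
RE-POINTING ORDER (2)(b) (2026-08-28): the deciding statement of the programme point FBP₀ as ONE `@[conjecture] def`, so that idea / critic seats can be
attached to a decl.

CONTEXT (memos `bschramm/FROM-fk-2-g39-MATROID-FRAME.md` §3.4, `bschramm/prim-bschramm-fk-2-g40/PROOF-GENERIC.md` §0–§1, FK-Q2.md §44.2 / §48.8 / §49.2 /
§50).  The `q < 1` negative-association programme for the random-cluster measure on series–parallel graphs was reduced (gens 35–38) to the levelwise
statement `(ID)_J`: the doubly odd kernel `D_J = 1{L∘τ ≤ J} − 1{L ≤ J}` of a cell is a nonnegative combination of ELEMENTARY SQUARES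
`δ_γ + δ_{γ+e+e'} − δ_{γ+e} − δ_{γ+e'}` — the hypothesis of the tree's checker `FK.levels_le_of_squareCert` (file 77a), which turns such a certificate into
the levelwise antipodal inequality `Σ_{L ≤ J} f̂ĝ ≤ 0` and thence (Abel bridge, dictionary) into `Cov_{φ_{w,q}}(f,g) ≤ 0` for `0 < q ≤ 1`.  Gen 39 observed
that for the CANONICAL colouring of a graph `G₀` (every edge `a` subdivided into an `S`-half `x_a` and an `N`-half `y_a`) the level depends on `G₀` only
through its cycle matroid: with `x, y ⊆ A` the sets of present `S`-halves and `N`-halves, `L = 2|V(G₀)| + null(x ∩ y) + null((x ∪ y)ᶜ)` and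
`L∘τ = 2|V(G₀)| + null(x ∖ y) + null(y ∖ x)` (`null F = |F| − rk F`), and that the resulting statement makes sense — and survives every exact test — for an
ARBITRARY matroid.  This file types that statement with the minimal posited objects, REUSING the tree's nullity
`Literature.Combinatorics.Matroid.corank M F = |F| − rk_M F` («Literature/Combinatorics/Matroid/HeppBound», Panzer 2022 §2.3; Oxley's nullity; Mathlib's
`Matroid.eRk` read back in `ℕ`; elements outside `M.E` count as loops):
* the PAIR SPACE `Finset α × Finset α` (curried), the ALIGNED level `FK.alignedNullLevel M x y = corank(x ∩ y) + corank(xᶜ ∩ yᶜ)` and the TWISTED level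
  `FK.twistedNullLevel M x y = corank(x ∖ y) + corank(y ∖ x)` (`= alignedNullLevel M xᶜ y`, `FK.twistedNullLevel_eq_alignedNullLevel_compl`);
* the kernel `FK.conjCKernel M J (x, y) = 1{twisted ≤ J} − 1{aligned ≤ J}`;
* the SQUARE CONE `Sq(2^A × 2^A)` in the functional form of file 77a: `FK.IsPairSquareCert K c` says the nonnegative weights `c x y a b` write `K` as
  `Σ c·(δ_{(x,y)} + δ_{(x+a,y+b)} − δ_{(x+a,y)} − δ_{(x,y+b)})` when tested against every `Φ`; `FK.InPairSquareCone K := ∃ c, IsPairSquareCert K c`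
  (equivalently, by LP duality on a finite-dimensional space: `Σ K·Φ ≥ 0` for every `Φ` with increasing differences
  `Φ(x,y) + Φ(x+a,y+b) − Φ(x+a,y) − Φ(x,y+b) ≥ 0` — 'ID-dominance'; big squares `(δ_{x'} − δ_x) ⊗ (δ_{y'} − δ_y)`, `x ⊆ x'`, `y ⊆ y'`, telescope into
  elementary ones, so the cone of big squares of file 77d is the same cone);
* `FK.ConjectureCOn α := ∀ M : Matroid α, ∀ J, InPairSquareCone (conjCKernel M J)` and the node **`FK.ConjectureC := ∀ n, ConjectureCOn (Fin n)`**.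
SANITY (kernel): the free matroid passes at every level with the zero certificate (`FK.conjectureCOn_freeOn`); the one-loop matroid `U_{0,1}` at level `0` has
the kernel `δ_{(∅,∅)} + δ_{({0},{0})} − δ_{({0},∅)} − δ_{(∅,{0})}` = ONE elementary square with weight `1` (`FK.inPairSquareCone_loopyOn_fin_one`) — the sign and
the square shape are the ones fk-2's certificates certify.
CONNECTIVITY FORM (PROOF-GENERIC §1, not typed): with `ν = null(A)`, `δ(x,y) = rk(x∩y) + rk((x∪y)ᶜ) + |x △ y| − rk M = ν − aligned`,
`δ̃(x,y) = δ(xᶜ,y) = ν − twisted`, Conjecture C reads `1{δ ≤ k} − 1{δ̃ ≤ k} ∈ Sq` for every depth `k = ν − 1 − J`: pairs of small ALIGNED defect are more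
concordant than pairs of small TWISTED defect; `δ(x,x) = λ_M(x)` is the connectivity function.
STATUS OF THE NODE (pen and exact computation by fk-2, gens 39–41; NOT kernel): THEOREM C (g40) — all levels of every uniform `U_{r,n}` with `2r ≥ n − 1`;
THEOREM L (g41) — every level `J ≤ (N − 4c)/2` of every `U_{c,N}`; THEOREM U2 (g41) — every level of every `U_{2,N}`; the theta-graph theorem (g37, rings
`U_{k−1,k}` / thetas `U_{1,k}` of bundles); direct sums (Abel summation); the top level of every connected matroid.  LP census, 0 failures (numbers as in FK-Q2
§48.13–§50.5, HiGHS LPs with exact rational certificates where stated): all 474 matroids on ≤ 7 elements (bounded Farkas LPs; exact certificates for the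
small ones) and all 1 724 matroids on 8 elements at every level below the top (§49.7; the one float-infeasible non-Pappus cell of §48.17 was an IPM artefact,
a primal certificate was found, §49.1); uniform matroids: every `U_{r,n}`, `n ≤ 16`, by LP (§49.4) and the symmetry-reduced HiGHS LPs for `2 ≤ c ≤ 6`, `N ≤ 24`,
695/695 (§50.5; EXACT rational certificates for the `c = 2` band through `N = 13`, the other ranks pen by Theorems C / L and duality); `Aut`-folded LPs with
exact symmetric certificates for `F_7`, `F_7^*`, `AG(3,2)` and float/IPM passes for `F_7^−`, `P_7`, `AG(2,3)`, `M(W_4)`, Pappus, non-Pappus and the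
non-representable Vámos matroid `V_8` (§48.13–§48.17).  KNOWN TO FAIL for the analogous kernel of general polymatroids / sums of two rank functions (FK-Q2
§48.14–§48.16) — the statement is about ONE matroid.  Open: the general matroid; closure under 2-sums (which with Theorem C and the theta theorem would
give every series–parallel matroid, i.e. `(ID)` for the canonical colouring of every SP graph).
TODO(bridge, not claimed here): for a finite graph `G₀` and `M = M(G₀)` its cycle matroid on the edge set (Mathlib's `Matroid` has no cycle-matroid-of-a-graph
construction; the tree holds its RANK FUNCTION `rank (fromEdgeSet S) = n − c` with independent sets = forests in «Literature/Combinatorics/SimpleGraph/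
CycleMatroidRankFunction», Godsil–Royle §15 — the bridge's entry point, either as a `Matroid (Sym2 V)` built from it by Mathlib's finite-rank constructors or
with the bridge stated in corank-of-rank-function form), a pair square certificate of `conjCKernel M J` IS a square certificate, in the sense of
`FK.levels_le_of_squareCert`, for the subdivided graph `sd(G₀)` with `S` = the `S`-halves, `C = ∅` and level `J + 2|V(G₀)|`
(`apExpC (E(sd G₀)) ∅ γ = 2|V(G₀)| + alignedNullLevel M x y` under `γ ↔ (x,y)`);
hence `ConjectureC` ⟹ `C_∞⁺` at every level, hence negative association of `φ_{w,q}`, `0 < q ≤ 1`, across the canonical split of every `sd(G₀)`.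
TODO(general form): the lane's full conjecture (`(ID)` for ARBITRARY colourings `S ⊔ N` of SP graphs, FK-Q2 §44) is not of this form; its typed
deciding statement today is `FK.SPGoodPos` («FKConnectivityAllQPat3SPConjecture»).  PRESEARCH (corpus hybrid + vector + galaxy, 2026-08-28): no statement of
this kind in print; nearest print context = negative correlation / the Rayleigh and balance conditions for the uniform measures on bases, independent sets or
spanning sets of ONE matroid (Feder–Mihail 1992, Semple–Welsh 2008, Wagner 2008) — single-edge events under one measure, whereas `(ID)_J` compares the TWO-sample
concordance of two nullity levels — and Grimmett's list of open `q < 1` questions for the random-cluster measure.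
[cite: Oxley2011, §1.3 (rank, nullity), §8.1 (connectivity function λ_M)] [cite: SempleWelsh2008, §1–§2] [cite: Grimmett2006, §3.9 (pp. 63–64)]
[cite: Wagner2006, Thm. 5.8(d), §5.3]
-/

noncomputable section

namespace Summit.CriticalPhenomena.PercolationContinuityZ3.Theorems

namespace FK

open Literature.Combinatorics.Matroid
open scoped Classical

variable {α : Type*}

/-! ### The matroid frame: the two nullity levels and the kernel (nullity = the tree's `corank`) -/

/-- **Aligned nullity level** of a pair `(x, y) ∈ 2^A × 2^A`: `Λ_M(x,y) = null(x ∩ y) + null(xᶜ ∩ yᶜ)`, the nullity `|F| − rk F` (Oxley §1.3) being the tree's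
`Literature.Combinatorics.Matroid.corank` — for the cycle matroid of `G₀` and the canonical colouring of `sd(G₀)`, the antipodal cluster exponent of the
configuration `γ ↔ (x,y)` minus `2|V(G₀)|` (memo FROM-fk-2-g39 §3.4). [cite: Oxley2011, §1.3] [cite: Panzer2022, §2.3 (corank)] -/
def alignedNullLevel [Fintype α] (M : Matroid α) (x y : Finset α) : ℕ :=
  corank M (x ∩ y) + corank M (xᶜ ∩ yᶜ)

/-- **Twisted nullity level** `Λ_M(τ(x,y)) = null(x ∖ y) + null(y ∖ x)` — the aligned level of the pair with its first coordinate complemented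
(`twistedNullLevel_eq_alignedNullLevel_compl`). [cite: Oxley2011, §1.3] [cite: Panzer2022, §2.3 (corank)] -/
def twistedNullLevel (M : Matroid α) (x y : Finset α) : ℕ :=
  corank M (x \ y) + corank M (y \ x)

/-- **The doubly odd kernel of Conjecture C** at level `J`: `D_J(x,y) = 1{Λ(τ(x,y)) ≤ J} − 1{Λ(x,y) ≤ J}` (twisted minus aligned, as in the hypothesis
`hcert` of `FK.levels_le_of_squareCert`). [cite: Grimmett2006, §3.9 (pp. 63–64)] -/
def conjCKernel [Fintype α] (M : Matroid α) (J : ℕ) (x y : Finset α) : ℝ :=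
  (if twistedNullLevel M x y ≤ J then 1 else 0) - (if alignedNullLevel M x y ≤ J then 1 else 0)

/-! ### The square cone on the pair space (functional form of file 77a) -/

/-- **Pair square certificate** (functional form): nonnegative weights `c x y a b` (`a, b : α`; a square with `a ∈ x` or `b ∈ y` is zero) such that
`Σ_{x,y} K(x,y)·Φ(x,y) = Σ_{x,y,a,b} c·(Φ(x,y) + Φ(x+a,y+b) − Φ(x+a,y) − Φ(x,y+b))` for EVERY test function `Φ` — i.e. `K` is the nonnegative combination
`Σ c·(δ_{(x,y)} + δ_{(x+a,y+b)} − δ_{(x+a,y)} − δ_{(x,y+b)})` of elementary squares `(δ_{x+a} − δ_x) ⊗ (δ_{y+b} − δ_y)`.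
[cite: Grimmett2006, §3.8 Thm. (3.90) (pp. 61–62)] [cite: Wagner2006, Thm. 5.8(d), §5.3] -/
def IsPairSquareCert [Fintype α] (K : Finset α → Finset α → ℝ) (c : Finset α → Finset α → α → α → ℝ) : Prop :=
  (∀ x y a b, 0 ≤ c x y a b) ∧
    ∀ Φ : Finset α → Finset α → ℝ,
      ∑ x : Finset α, ∑ y : Finset α, K x y * Φ x y =
        ∑ x : Finset α, ∑ y : Finset α, ∑ a : α, ∑ b : α,
          c x y a b * (Φ x y + Φ (insert a x) (insert b y) - Φ (insert a x) y - Φ x (insert b y))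

/-- **Membership in the square cone `Sq(2^A × 2^A)`**: some pair square certificate exists (by LP duality: `Σ K·Φ ≥ 0` for every `Φ` with increasing
differences between the two coordinates — 'ID-dominance', FK-Q2 §44.2). [cite: Wagner2006, Thm. 5.8(d), §5.3] -/
def InPairSquareCone [Fintype α] (K : Finset α → Finset α → ℝ) : Prop :=
  ∃ c : Finset α → Finset α → α → α → ℝ, IsPairSquareCert K c

/-! ### The node -/

/-- **Conjecture C on the ground type `α`**: for every matroid `M` on `α` and every level `J`, the kernel `1{Λ∘τ ≤ J} − 1{Λ ≤ J}` lies in the square cone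
of the pair space.  (Matroids with `M.E ≠ univ` are covered as the same matroid with loops adjoined off `M.E`.) [cite: Oxley2011, §1.3; §8.1] -/
def ConjectureCOn (β : Type*) [Fintype β] : Prop :=
  ∀ M : Matroid β, ∀ J : ℕ, InPairSquareCone (conjCKernel M J)

/-- **Conjecture node `ConjectureC` (fk-2's matroid statement `(ID)_J`, NOT asserted): for EVERY finite matroid `M` and EVERY level `J`,
`1{null(x∖y) + null(y∖x) ≤ J} − 1{null(x∩y) + null((x∪y)ᶜ) ≤ J} ∈ Sq(2^A × 2^A)`** (memo FROM-fk-2-g39-MATROID-FRAME §3.4; connectivity form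
`1{δ ≤ k} − 1{δ̃ ≤ k} ∈ Sq`, PROOF-GENERIC §1).  Evidence and proved sub-families (pen + exact certificates, not kernel): uniform matroids `U_{r,n}` with
`2r ≥ n − 1` (all levels), `U_{2,N}` (all levels), `U_{c,N}` at levels `J ≤ (N − 4c)/2`, thetas / rings of bundles, direct sums, top level of every connected
matroid; LP census with 0 failures over every matroid on ≤ 8 elements (§49.7), every uniform `U_{r,n}` with `n ≤ 16` (§49.4) and — symmetry-reduced HiGHS LPs,
exact rational certificates for `c = 2`, `N ≤ 13` — every `U_{c,N}` with `2 ≤ c ≤ 6`, `N ≤ 24` (§50.5), and `F_7, F_7^*, AG(3,2)` (exact), `AG(2,3), M(W_4)`, Pappus,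
non-Pappus, Vámos (float/IPM) (FK-Q2 §48–§50).  The analogous statement for general polymatroids is FALSE (FK-Q2 §48.14).  No statement of this kind was found
in print; the nearest context is the Rayleigh / negative-correlation theory of matroids and Grimmett's open `q < 1` questions.
[cite: Grimmett2006, §3.9 (pp. 63–64)] [cite: Wagner2006, Thm. 5.8(d), §5.3] [cite: Oxley2011, §8.1] -/
@[conjecture] def ConjectureC : Prop := ∀ n : ℕ, ConjectureCOn (Fin n)

/-! ### Definitional lemmas -/

/-- An independent finite set has nullity (`corank`) `0`. [cite: Oxley2011, §1.3] -/
theorem corank_eq_zero_of_indep {M : Matroid α} {F : Finset α} (hF : M.Indep (F : Set α)) : corank M F = 0 := by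
  unfold corank
  rw [hF.eRk_eq_encard, Set.encard_coe_eq_coe_finsetCard, ENat.toNat_coe, Nat.sub_self]

/-- The aligned level is symmetric in the pair. [folklore] -/
theorem alignedNullLevel_comm [Fintype α] (M : Matroid α) (x y : Finset α) : alignedNullLevel M x y = alignedNullLevel M y x := by
  unfold alignedNullLevel
  rw [Finset.inter_comm x y, Finset.inter_comm xᶜ yᶜ]

/-- The twisted level is symmetric in the pair. [folklore] -/
theorem twistedNullLevel_comm (M : Matroid α) (x y : Finset α) : twistedNullLevel M x y = twistedNullLevel M y x := by
  unfold twistedNullLevel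
  rw [add_comm]

/-- **`Λ∘τ`**: the twisted level of `(x, y)` is the aligned level of `(xᶜ, y)` (complementing the first coordinate = the `S`-flip of file 77a). [folklore] -/
theorem twistedNullLevel_eq_alignedNullLevel_compl [Fintype α] (M : Matroid α) (x y : Finset α) :
    twistedNullLevel M x y = alignedNullLevel M xᶜ y := by
  unfold twistedNullLevel alignedNullLevel
  rw [compl_compl, add_comm, Finset.sdiff_eq_inter_compl, Finset.sdiff_eq_inter_compl, Finset.inter_comm y xᶜ]

/-- The aligned level is invariant under complementing BOTH coordinates. [folklore] -/
theorem alignedNullLevel_compl_compl [Fintype α] (M : Matroid α) (x y : Finset α) :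
    alignedNullLevel M xᶜ yᶜ = alignedNullLevel M x y := by
  unfold alignedNullLevel
  rw [compl_compl, compl_compl, add_comm]

/-- Elementary squares are nonnegative on every `Φ` with increasing differences, hence so is every kernel in the square cone ('ID-dominance', the easy
direction of the LP duality of FK-Q2 §44.2). [cite: Wagner2006, Thm. 5.8(d), §5.3] -/
theorem sum_mul_nonneg_of_inPairSquareCone [Fintype α] {K : Finset α → Finset α → ℝ} (hK : InPairSquareCone K)
    (Φ : Finset α → Finset α → ℝ)
    (hΦ : ∀ (x y : Finset α) (a b : α), 0 ≤ Φ x y + Φ (insert a x) (insert b y) - Φ (insert a x) y - Φ x (insert b y)) :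
    0 ≤ ∑ x : Finset α, ∑ y : Finset α, K x y * Φ x y := by
  obtain ⟨c, hc, hcert⟩ := hK
  rw [hcert Φ]
  exact Finset.sum_nonneg fun x _ => Finset.sum_nonneg fun y _ => Finset.sum_nonneg fun a _ =>
    Finset.sum_nonneg fun b _ => mul_nonneg (hc x y a b) (hΦ x y a b)

/-- **Non-vacuity of the certificate shape: the free matroid satisfies Conjecture C at every level** (all nullities vanish, the kernel is identically
zero, the zero weights are a certificate). [cite: Oxley2011, §1.3] -/
theorem conjectureCOn_freeOn [Fintype α] (J : ℕ) : InPairSquareCone (conjCKernel (Matroid.freeOn (Set.univ : Set α)) J) := by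
  have hnull : ∀ F : Finset α, corank (Matroid.freeOn (Set.univ : Set α)) F = 0 := fun F =>
    corank_eq_zero_of_indep (by rw [Matroid.freeOn_indep_iff]; exact Set.subset_univ _)
  have hK : ∀ x y : Finset α, conjCKernel (Matroid.freeOn (Set.univ : Set α)) J x y = 0 := by
    intro x y
    unfold conjCKernel twistedNullLevel alignedNullLevel
    simp only [hnull, add_zero, zero_le, if_true, sub_self]
  refine ⟨fun _ _ _ _ => 0, fun _ _ _ _ => le_rfl, fun Φ => ?_⟩
  simp only [hK, zero_mul, Finset.sum_const_zero]

/-! ### A sanity instance with a nonzero certificate: the one-loop matroid `U_{0,1}` at level `0` -/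

/-- In the rank-zero matroid (every element a loop) the nullity (`corank`) of a finite set is its size. [cite: Oxley2011, §1.3] -/
theorem corank_loopyOn (E : Set α) (F : Finset α) : corank (Matroid.loopyOn E) F = F.card := by
  unfold corank
  rw [Matroid.eRk_loopyOn]
  simp

/-- Every subset of `Fin 1` is `∅` or `{0}`. [folklore] -/
theorem conjC_finset_fin_one_eq (x : Finset (Fin 1)) : x = ∅ ∨ x = {0} := by
  have h := Finset.subset_univ x
  rw [univ_eq_singleton_of_card_one (0 : Fin 1) (Fintype.card_fin 1), Finset.subset_singleton_iff] at h
  exact h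

/-- A sum over the subsets of `Fin 1` has the two terms `∅` and `{0}`. [folklore] -/
theorem conjC_sum_finset_fin_one (f : Finset (Fin 1) → ℝ) : ∑ x : Finset (Fin 1), f x = f ∅ + f {0} := by
  have hp : ({0} : Finset (Fin 1)).powerset = {∅, {0}} := by
    rw [← Finset.insert_empty, Finset.powerset_insert, Finset.powerset_empty]
    simp
  rw [← Finset.powerset_univ, univ_eq_singleton_of_card_one (0 : Fin 1) (Fintype.card_fin 1), hp,
    Finset.sum_pair (Finset.singleton_ne_empty 0).symm]

/-- **Sanity instance with a NONZERO certificate (the sign and the square shape are the intended ones): the one-loop matroid `U_{0,1}` at level `0`.**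
On `Fin 1` with the rank-zero matroid, `null F = |F|`, the twisted level of `(x,y)` is `|x △ y|` and the aligned level is `1 − |x △ y|`, so
`D_0 = δ_{(∅,∅)} + δ_{({0},{0})} − δ_{({0},∅)} − δ_{(∅,{0})}` — exactly ONE elementary square (`x = y = ∅`, `a = b = 0`) with weight `1`
(the `n = 1` case of the bouquet; PROOF-GENERIC §0's '`a = b` allowed' is used). [cite: Oxley2011, §1.3] -/
theorem inPairSquareCone_loopyOn_fin_one : InPairSquareCone (conjCKernel (Matroid.loopyOn (Set.univ : Set (Fin 1))) 0) := by
  -- the four kernel values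
  have hK : ∀ x y : Finset (Fin 1), conjCKernel (Matroid.loopyOn (Set.univ : Set (Fin 1))) 0 x y =
      (if x = ∅ ∧ y = ∅ then 1 else 0) + (if x = {0} ∧ y = {0} then 1 else 0)
        - (if x = {0} ∧ y = ∅ then 1 else 0) - (if x = ∅ ∧ y = {0} then 1 else 0) := by
    intro x y
    unfold conjCKernel twistedNullLevel alignedNullLevel
    simp only [corank_loopyOn, Finset.compl_eq_univ_sdiff, univ_eq_singleton_of_card_one (0 : Fin 1) (Fintype.card_fin 1)]
    rcases conjC_finset_fin_one_eq x with rfl | rfl <;> rcases conjC_finset_fin_one_eq y with rfl | rfl <;> simp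
  -- the certificate: weight 1 on the single square at (∅, ∅) (for `Fin 1` the indices `a = b = 0` are forced)
  refine ⟨fun x y _ _ => if x = ∅ ∧ y = ∅ then 1 else 0, fun x y _ _ => by positivity, fun Φ => ?_⟩
  simp only [conjC_sum_finset_fin_one, Fin.sum_univ_one, hK]
  simp
  ring

end FK

end Summit.CriticalPhenomena.PercolationContinuityZ3.Theorems

end
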